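import Summits.CriticalPhenomena.PercolationContinuityZ3.Theorems.Transplant.SkelSeedSlabDeepKit
import Summits.CriticalPhenomena.PercolationContinuityZ3.Theorems.Transplant.SkelCubeAt
import Summits.CriticalPhenomena.PercolationContinuityZ3.Theorems.Transplant.SkelDeepRoute
import HarnessLib

/-!
# L5.5b/L5.6b bridge (generic design-(D) re-typing) — the near-contact face conditions `SkelI.NearFaceOKDeep` of the DEEP seed slab
# (`SkelSeedSlabDeep(Kit)`, v3: slab centre `SkelI.deepCtr`, exit offset `ℓs + 1`, tangential depth `≥ T₀ = 2ℓs + 2 + M`) are met by the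
# Lemma-9 cube face behind the slab (`Skel.cubeFace` of `SkelCubeAt`), and the cube and its face lie in the Step-V SHELL window
# (SHEAR-SCOPE §3.9 L5.5/L5.6, §3.10 (4); lane INBOX 2026-08-20 20:34:33Z (corner flag) / 20:40:27Z (v3))

builds on p205010 (kernel theorem, internal audit signed; external expert review pending) — nothing in this file uses p205010.
Lane `prim-bschramm`, seat `prim-bschramm-p3` (gen 4); helper file (`--supports stmt-CriticalPhenomena-4575 --as helper`).

For a candidate contact `x` of the window level `j` (`Lo = lo - j`, `Hi = hi + j`) with inner neighbour `y = inNbr x`, exit datum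
`(i, σ) = exitDir x` and deep slab centre `t = deepCtr … x` (`φ t i = φ y i - σ (ℓs + 1)`, `Lo + T₀ ≤ φ t (oth i) ≤ Hi - T₀`,
`d_G(y, t) ≤ ℓs + 1 + T₀`) the face is `cubeU x := Skel.cubeFace Φ hC t i σ ℓs M` — the `(i, σ)`-quarter-piece of the cube
`Skel.fatSeq Φ hC (cubeCtr t i σ ℓs M) M` at exit depths `[2ℓs + 2, 2ℓs + 2 + 2M]` and tangential depth `≥ T₀ - M = 2ℓs + 2`.  With
`M + 1 ≤ ℓs` and box sides `≥ 2 T₀`: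
* `cubeFace_slab_geom` (abstract slab centre) / **`cubeU_geom`** — every face vertex lies in `B_G(x, 2ℓs + 3 + T₀ + M + ψ M)`, in
  `B_G(y, 2ℓs + 2 + T₀ + M + ψ M)`, and has `φ u` in the SHELL BOX `Icc (Lo + (2ℓs+2)) (Hi - (2ℓs+2))` (so `hUsh` of
  `SkelI.slabSeedDeep_notMem_wireSet` holds for `Unear := cubeU`, at every candidate contact);
* **`cube_subset_shellWin`** — for a near contact (`y ∈ B_G(w₀, R - r₀)`, `r₀ ≥ 2ℓs + 2 + T₀ + M + ψ M`) the whole cube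
  `fatSeq (cubeCtr t i σ ℓs M) M` lies in the shell window `Φ.Win w₀ (Icc (Lo + (2ℓs+2)) (Hi - (2ℓs+2))) R` (the `hQS : Λ_M ⊆ S` of
  `KNLevels.stepIV_in` with `S :=` shell window `∪` far faces);
* **`cubeFace_subset_innerBoundary`** / **`cubeU_subset_innerBoundary_win`** — the face lies on the inner boundary of the cube in the
  exploration graph (any `Γ` making the rungs edges / the plain window graph), the `hUib` of `Skel.kit_hIV_of_le / kit_hIV_of_route`;
* **`nearFaceOK_cube`** — `NearFaceOKDeep Φ w₀ R lo hi j ℓs M R' r₀ rs cU (cubeU Φ hC w₀ R lo hi j ℓs M)` for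
  `R' ≥ cylRadMax ℓs (ℓs + 2 + M + ψ M)`, `2ℓs + 2 + T₀ + M + ψ M ≤ r₀ ≤ R`, `rs ≥ 2ℓs + 3 + T₀ + M + ψ M`, `cU ≥ (Δ+1)^{ψ M}`;
* **`kitOK_slabCube`** — the assembled `KitOK Φ w₀ R lo hi j rs ((Δ+1)^{R'} + (T₀ + 2)) cU (slabGeomDeep … (cubeU …))`
  (`kitOK_slabDeep` ∘ `nearFaceOK_cube`; `R'` dominates `cylRadMax ℓs (ℓs + 2 + 2T₀)` too).
The Step-IV inputs of these cubes are `Skel.exists_stepIV_inputs_win / _of_le` at the centre `Skel.cubeCtr t i σ ℓs M`.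

[cite: KozmaNitzan2024, §4 p. 19 (Step III: seeds and the plaquette behind a contact), p. 21 (U(P) ⊆ ∂Q, "Q ⊆ S", the cube v(P) + Λ_M behind P)]
-/

noncomputable section

open scoped Classical

namespace Summit.CriticalPhenomena.PercolationContinuityZ3.Theorems

namespace Transplant

namespace SkelI

open Literature.Probability.Percolation Literature.Probability.LatticeModels SimpleGraph KNLevels
open Literature.Barriers.CriticalPhenomena (graphBall graphBall_finite mem_graphBall_self graphBall_mono)
open Literature.Probability.Percolation.KozmaNitzan.Cells (oth oth_ne eq_oth_of_ne oth_oth)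
open Skel (winGraph winGraph_adj winLevel mem_winLevel_iff inNbr cylBall_mono cylBall_subset_cyl fatRadius fatSeq mem_fatSeq_iff
  fatSeq_subset_Win cubeCtr cubeCtr_spec φ_cubeCtr cubeFace φ_cubeFace cubeFace_subset_fatSeq cubeFace_subset_graphBall card_cubeFace_le
  exists_step_mem_cylBall_of_mem_cubeFace)

variable {V : Type} [DecidableEq V] {G : SimpleGraph V} [G.LocallyFinite] (Φ : PlanarSkeletonConc G)

/-! ## §1 The cube face behind the deep slab of a contact -/

/-- **The face of a near contact `x` of the window level `j`**: the `(i, σ)`-quarter-piece (`(i, σ) = exitDir x`) of the cube of scale `M`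
stacked `ℓs + 1 + M` inward of the deep slab centre `deepCtr … x` (`Skel.cubeFace`).
[cite: KozmaNitzan2024, §4 p. 21 (U(P): the boundary plaquettes of v(P) + Λ_M facing P)] -/
def cubeU [Countable V] {p : unitInterval} (hC : Φ.toPlanarSkeleton.CylSubcritical p) (w₀ : V) (R : ℕ) (lo hi : Site 2)
    (j ℓs M : ℕ) (x : V) : Finset V :=
  cubeFace Φ hC (deepCtr Φ w₀ R (lo - (j : Site 2)) (hi + (j : Site 2)) ℓs M x)
    (exitDir Φ w₀ R (lo - (j : Site 2)) (hi + (j : Site 2)) x).1 (exitDir Φ w₀ R (lo - (j : Site 2)) (hi + (j : Site 2)) x).2 ℓs M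

section Near

variable [Countable V] {p : unitInterval} (hC : Φ.toPlanarSkeleton.CylSubcritical p) {w₀ : V} {R : ℕ} {lo hi : Site 2} {j ℓs M : ℕ}

omit [DecidableEq V] in
/-- **Geometry of a cube face behind a slab centre `t`** (abstract): `y` adjacent to `x`, `t` within graph distance `D` of `y`; every vertex
`u` of the face `cubeFace t i σ ℓs M` lies in `B_G(x, D + ℓs + 2 + M + ψ M)` and in `B_G(y, D + ℓs + 1 + M + ψ M)`, and its skeleton
coordinates are `φ u i = φ t i - σ (ℓs + 1)`, `φ t (oth i) ≤ φ u (oth i) ≤ φ t (oth i) + M`. [cite: KozmaNitzan2024, §4 p. 21 (v(P) + Λ_M ⊆ S)] -/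
theorem cubeFace_slab_geom {x y t : V} {i : Fin 2} {σ : ℤˣ} {D : ℕ} (hadj : G.Adj x y) (hty : t ∈ graphBall G y D) {u : V}
    (hu : u ∈ cubeFace Φ hC t i σ ℓs M) :
    u ∈ graphBall G x (D + ℓs + 2 + M + fatRadius Φ hC M) ∧ u ∈ graphBall G y (D + ℓs + 1 + M + fatRadius Φ hC M) ∧
      Φ.φ u i = Φ.φ t i - (σ : ℤ) * (ℓs + 1) ∧ Φ.φ t (oth i) ≤ Φ.φ u (oth i) ∧ Φ.φ u (oth i) ≤ Φ.φ t (oth i) + M := by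
  have hut := cubeFace_subset_graphBall Φ hC t i σ ℓs M hu
  have huy : u ∈ graphBall G y (D + ℓs + 1 + M + fatRadius Φ hC M) :=
    graphBall_mono G y (by omega) (BoxProdZ2.mem_graphBall_add G hty hut)
  exact ⟨graphBall_mono G x (by omega) (BoxProdZ2.mem_graphBall_add G
    (BoxProdZ2.mem_graphBall_succ_of_adj G (mem_graphBall_self G x 0) hadj) huy), huy, φ_cubeFace Φ hC t i σ ℓs M hu⟩

/-- **Geometry of the face of a contact** `x` of the window level `j` (deep slab, box sides `≥ 2T₀`): every vertex of
`cubeU x` lies in `B_G(x, 2ℓs + 3 + T₀ + M + ψ M)`, in `B_G(inNbr x, 2ℓs + 2 + T₀ + M + ψ M)`, and in the SHELL BOX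
`Icc (Lo + (2ℓs+2)) (Hi - (2ℓs+2))` (exit coordinate `φ y i - σ(2ℓs+2)` with `φ y i` on the `σ`-face; tangential coordinate in
`[φ t, φ t + M] ⊆ [Lo + T₀, Hi - T₀ + M]`, `T₀ - M = 2ℓs + 2`). [cite: KozmaNitzan2024, §4 p. 21] -/
theorem cubeU_geom (hwide : ∀ i, (lo - (j : Site 2)) i + 2 * tanOff ℓs M ≤ (hi + (j : Site 2)) i) {x : V}
    (hx : x ∈ outerBoundary (winGraph G w₀ R) (winLevel Φ w₀ R lo hi j)) {u : V} (hu : u ∈ cubeU Φ hC w₀ R lo hi j ℓs M x) :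
    u ∈ graphBall G x (2 * ℓs + 3 + tanOff ℓs M + M + fatRadius Φ hC M) ∧
      u ∈ graphBall G (inNbr Φ w₀ R (Finset.Icc (lo - (j : Site 2)) (hi + (j : Site 2))) x)
        (2 * ℓs + 2 + tanOff ℓs M + M + fatRadius Φ hC M) ∧
      Φ.φ u ∈ Finset.Icc (lo - (j : Site 2) + ((2 * ℓs + 2 : ℕ) : Site 2)) (hi + (j : Site 2) - ((2 * ℓs + 2 : ℕ) : Site 2)) := by
  have hx' : x ∈ outerBoundary (winGraph G w₀ R) (Φ.Win w₀ (Finset.Icc (lo - (j : Site 2)) (hi + (j : Site 2))) R) := hx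
  obtain ⟨hadj, -, hyP⟩ := inNbr_spec Φ hx'
  have hty := (deepCtr_spec Φ (ℓs := ℓs) (M := M) hwide hyP).1
  have hexit := φ_deepCtr_exit Φ (ℓs := ℓs) (M := M) hwide hyP
  have htan := φ_deepCtr_tan Φ (ℓs := ℓs) (M := M) hwide hyP
  have htgt := tanTgt_mem (Lo := lo - (j : Site 2)) (Hi := hi + (j : Site 2)) (ℓs := ℓs) (M := M)
    (oth (exitDir Φ w₀ R (lo - (j : Site 2)) (hi + (j : Site 2)) x).1) (hwide _)
    (Φ.φ (inNbr Φ w₀ R (Finset.Icc (lo - (j : Site 2)) (hi + (j : Site 2))) x))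
  have hspec := exitDir_spec Φ hx'
  rw [cubeU] at hu
  obtain ⟨hux, huy, hexI, hlo, hhi⟩ := cubeFace_slab_geom Φ hC hadj hty hu
  refine ⟨graphBall_mono G x (by omega) hux, graphBall_mono G _ (by omega) huy, ?_⟩
  -- abstract the slab data: exit coordinate, sign, centre, inner neighbour
  generalize hI : (exitDir Φ w₀ R (lo - (j : Site 2)) (hi + (j : Site 2)) x).1 = I at hexit htan htgt hspec hexI hlo hhi
  generalize hS : (exitDir Φ w₀ R (lo - (j : Site 2)) (hi + (j : Site 2)) x).2 = sg at hexit hspec hexI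
  generalize hT : deepCtr Φ w₀ R (lo - (j : Site 2)) (hi + (j : Site 2)) ℓs M x = t at hexit htan hexI hlo hhi
  generalize hY : inNbr Φ w₀ R (Finset.Icc (lo - (j : Site 2)) (hi + (j : Site 2))) x = y at hyP hexit htan htgt hspec
  generalize hτ : tanTgt (lo - (j : Site 2)) (hi + (j : Site 2)) ℓs M (oth I) (Φ.φ y) = τ at htan htgt
  rw [Finset.mem_Icc] at hyP
  obtain ⟨hyl, hyh⟩ := hyP
  have hT₀ : (tanOff ℓs M : ℤ) = 2 * ℓs + 2 + M := by simp [tanOff]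
  have hwI := hwide I
  -- the exit coordinate: `φ u I = φ y I - sg (2ℓs + 2)` with `φ y I` on the `sg`-face
  have huI : (lo - (j : Site 2)) I + (2 * ℓs + 2 : ℕ) ≤ Φ.φ u I ∧ Φ.φ u I ≤ (hi + (j : Site 2)) I - (2 * ℓs + 2 : ℕ) := by
    rcases hspec with ⟨rfl, hf⟩ | ⟨rfl, hf⟩ <;> push_cast at hexI hexit ⊢ <;> constructor <;> linarith
  -- the tangential coordinate: `φ t (oth I) = τ ∈ [Lo + T₀, Hi - T₀]`, `φ u ∈ [φ t, φ t + M]`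
  have huO : (lo - (j : Site 2)) (oth I) + (2 * ℓs + 2 : ℕ) ≤ Φ.φ u (oth I) ∧
      Φ.φ u (oth I) ≤ (hi + (j : Site 2)) (oth I) - (2 * ℓs + 2 : ℕ) := by
    push_cast at htgt ⊢
    constructor <;> linarith [htgt.1, htgt.2]
  rw [Finset.mem_Icc]
  constructor <;> intro k
  · have goal : (lo - (j : Site 2) + ((2 * ℓs + 2 : ℕ) : Site 2)) k ≤ Φ.φ u k := by
      rw [Pi.add_apply, Pi.natCast_apply]
      by_cases hk : k = I
      · rw [hk]; exact huI.1
      · rw [eq_oth_of_ne hk]; exact huO.1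
    exact goal
  · have goal : Φ.φ u k ≤ (hi + (j : Site 2) - ((2 * ℓs + 2 : ℕ) : Site 2)) k := by
      rw [Pi.sub_apply, Pi.natCast_apply]
      by_cases hk : k = I
      · rw [hk]; exact huI.2
      · rw [eq_oth_of_ne hk]; exact huO.2
    exact goal

/-- The shell box lies in the level box. [folklore] -/
theorem mem_Icc_of_mem_shell {Lo Hi : Site 2} {n : ℕ} {z : Site 2}
    (hz : z ∈ Finset.Icc (Lo + ((n : ℕ) : Site 2)) (Hi - ((n : ℕ) : Site 2))) : z ∈ Finset.Icc Lo Hi := by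
  rw [Finset.mem_Icc] at hz ⊢
  obtain ⟨h1, h2⟩ := hz
  constructor <;> intro k
  · have hk : Lo k + (n : ℤ) ≤ z k := h1 k
    have goal : Lo k ≤ z k := by omega
    exact goal
  · have hk : z k ≤ Hi k - (n : ℤ) := h2 k
    have goal : z k ≤ Hi k := by omega
    exact goal

/-- **The cube behind the deep slab of a NEAR contact lies in the shell window** `Win w₀ (Icc (Lo + (2ℓs+2)) (Hi - (2ℓs+2))) R`
(`y ∈ B_G(w₀, R - r₀)` with `r₀ ≥ 2ℓs + 2 + T₀ + M + ψ M`, box sides `≥ 2T₀`): the `hQS : Λ_M ⊆ S` of Step IV with `S ⊇` the shell window.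
[cite: KozmaNitzan2024, §4 p. 21 ("Q ⊆ S")] -/
theorem cube_subset_shellWin {r₀ : ℕ} (hwide : ∀ i, (lo - (j : Site 2)) i + 2 * tanOff ℓs M ≤ (hi + (j : Site 2)) i)
    (hr₀ : 2 * ℓs + 2 + tanOff ℓs M + M + fatRadius Φ hC M ≤ r₀) (hR : r₀ ≤ R) {x : V}
    (hx : x ∈ outerBoundary (winGraph G w₀ R) (winLevel Φ w₀ R lo hi j))
    (hnear : inNbr Φ w₀ R (Finset.Icc (lo - (j : Site 2)) (hi + (j : Site 2))) x ∈ graphBall G w₀ (R - r₀)) :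
    fatSeq Φ hC (cubeCtr Φ (deepCtr Φ w₀ R (lo - (j : Site 2)) (hi + (j : Site 2)) ℓs M x)
        (exitDir Φ w₀ R (lo - (j : Site 2)) (hi + (j : Site 2)) x).1 (exitDir Φ w₀ R (lo - (j : Site 2)) (hi + (j : Site 2)) x).2 ℓs M) M ⊆
      Φ.Win w₀ (Finset.Icc (lo - (j : Site 2) + ((2 * ℓs + 2 : ℕ) : Site 2)) (hi + (j : Site 2) - ((2 * ℓs + 2 : ℕ) : Site 2))) R := by
  have hx' : x ∈ outerBoundary (winGraph G w₀ R) (Φ.Win w₀ (Finset.Icc (lo - (j : Site 2)) (hi + (j : Site 2))) R) := hx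
  obtain ⟨-, -, hyP⟩ := inNbr_spec Φ hx'
  have hty := (deepCtr_spec Φ (ℓs := ℓs) (M := M) hwide hyP).1
  have hexit := φ_deepCtr_exit Φ (ℓs := ℓs) (M := M) hwide hyP
  have htan := φ_deepCtr_tan Φ (ℓs := ℓs) (M := M) hwide hyP
  have htgt := tanTgt_mem (Lo := lo - (j : Site 2)) (Hi := hi + (j : Site 2)) (ℓs := ℓs) (M := M)
    (oth (exitDir Φ w₀ R (lo - (j : Site 2)) (hi + (j : Site 2)) x).1) (hwide _)
    (Φ.φ (inNbr Φ w₀ R (Finset.Icc (lo - (j : Site 2)) (hi + (j : Site 2))) x))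
  have hspec := exitDir_spec Φ hx'
  have hc := cubeCtr_spec Φ (deepCtr Φ w₀ R (lo - (j : Site 2)) (hi + (j : Site 2)) ℓs M x)
    (exitDir Φ w₀ R (lo - (j : Site 2)) (hi + (j : Site 2)) x).1 (exitDir Φ w₀ R (lo - (j : Site 2)) (hi + (j : Site 2)) x).2 ℓs M
  have hφc := φ_cubeCtr Φ (deepCtr Φ w₀ R (lo - (j : Site 2)) (hi + (j : Site 2)) ℓs M x)
    (exitDir Φ w₀ R (lo - (j : Site 2)) (hi + (j : Site 2)) x).1 (exitDir Φ w₀ R (lo - (j : Site 2)) (hi + (j : Site 2)) x).2 ℓs M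
  refine fatSeq_subset_Win Φ hC (fun v hv => ?_) (fun b hb => ?_)
  · -- depth: `c` within `ℓs+1+T₀ + (ℓs+1+M)` of `y`, `y` within `R - r₀` of `w₀`
    have hcy := BoxProdZ2.mem_graphBall_add G hty hc.1
    have hcw := BoxProdZ2.mem_graphBall_add G hnear hcy
    exact graphBall_mono G w₀ (by omega) (BoxProdZ2.mem_graphBall_add G hcw hv)
  · -- planar: the cube's box about `φ c` lies in the shell box
    generalize hI : (exitDir Φ w₀ R (lo - (j : Site 2)) (hi + (j : Site 2)) x).1 = I at hexit htan htgt hspec hφc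
    generalize hS : (exitDir Φ w₀ R (lo - (j : Site 2)) (hi + (j : Site 2)) x).2 = sg at hexit hspec hφc
    generalize hC' : cubeCtr Φ (deepCtr Φ w₀ R (lo - (j : Site 2)) (hi + (j : Site 2)) ℓs M x) I sg ℓs M = c at hφc
    generalize hT : deepCtr Φ w₀ R (lo - (j : Site 2)) (hi + (j : Site 2)) ℓs M x = t at hexit htan hφc
    generalize hY : inNbr Φ w₀ R (Finset.Icc (lo - (j : Site 2)) (hi + (j : Site 2))) x = y at hyP hexit htan htgt hspec
    generalize hτ : tanTgt (lo - (j : Site 2)) (hi + (j : Site 2)) ℓs M (oth I) (Φ.φ y) = τ at htan htgt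
    rw [Finset.mem_Icc] at hyP
    obtain ⟨hyl, hyh⟩ := hyP
    obtain ⟨hcI, hcO⟩ := hφc
    rw [mem_box] at hb
    have hT₀ : (tanOff ℓs M : ℤ) = 2 * ℓs + 2 + M := by simp [tanOff]
    have hwI := hwide I
    have hwO := hwide (oth I)
    have hbI := hb I
    have hbO := hb (oth I)
    have hI' : (lo - (j : Site 2)) I + (2 * ℓs + 2 : ℕ) ≤ Φ.φ c I + b I ∧ Φ.φ c I + b I ≤ (hi + (j : Site 2)) I - (2 * ℓs + 2 : ℕ) := by
      rcases hspec with ⟨rfl, hf⟩ | ⟨rfl, hf⟩ <;> push_cast at hcI hexit ⊢ <;> constructor <;> linarith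
    have hO' : (lo - (j : Site 2)) (oth I) + (2 * ℓs + 2 : ℕ) ≤ Φ.φ c (oth I) + b (oth I) ∧
        Φ.φ c (oth I) + b (oth I) ≤ (hi + (j : Site 2)) (oth I) - (2 * ℓs + 2 : ℕ) := by
      push_cast at htgt ⊢
      constructor <;> linarith [htgt.1, htgt.2]
    rw [Finset.mem_Icc]
    constructor <;> intro k
    · have goal : (lo - (j : Site 2) + ((2 * ℓs + 2 : ℕ) : Site 2)) k ≤ (Φ.φ c + b) k := by
        rw [Pi.add_apply, Pi.natCast_apply, Pi.add_apply]
        by_cases hk : k = I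
        · rw [hk]; exact hI'.1
        · rw [eq_oth_of_ne hk]; exact hO'.1
      exact goal
    · have goal : (Φ.φ c + b) k ≤ (hi + (j : Site 2) - ((2 * ℓs + 2 : ℕ) : Site 2)) k := by
        rw [Pi.sub_apply, Pi.natCast_apply, Pi.add_apply]
        by_cases hk : k = I
        · rw [hk]; exact hI'.2
        · rw [eq_oth_of_ne hk]; exact hO'.2
      exact goal


omit [DecidableEq V] in
/-- **The cube face lies on the inner boundary of the cube in the exploration graph `Γ`** (`hUib` of `Skel.kit_hIV_of_le/_of_route`):
every face vertex `u` has its outward `step`-neighbour `v` in the slab cylinder `cyl(t, ℓs)`, hence outside the cube (coordinate `i`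
separates: the cube's `i`-coordinates are `≥ ℓs + 1` away from `φ t i`), and `u — v` is a `Γ`-edge by hypothesis.
[cite: KozmaNitzan2024, §4 p. 21 (U(P) ⊆ ∂Q)] -/
theorem cubeFace_subset_innerBoundary [DecidableEq V] {Γ : SimpleGraph V} [Γ.LocallyFinite] {t : V} {i : Fin 2} {σ : ℤˣ}
    (hMℓ : M + 1 ≤ ℓs)
    (hΓ : ∀ u ∈ cubeFace Φ hC t i σ ℓs M, ∀ v ∈ Φ.cylBall t ℓs (Φ.cylRadMax ℓs (ℓs + 2 + M + fatRadius Φ hC M)),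
      G.Adj v u → Γ.Adj u v) :
    cubeFace Φ hC t i σ ℓs M ⊆ innerBoundary Γ (fatSeq Φ hC (cubeCtr Φ t i σ ℓs M) M) := by
  intro u hu
  rw [mem_innerBoundary_iff]
  refine ⟨cubeFace_subset_fatSeq Φ hC t i σ ℓs M hu, ?_⟩
  obtain ⟨v, hv, hvu⟩ := exists_step_mem_cylBall_of_mem_cubeFace Φ hC t i σ ℓs M hMℓ hu
  refine ⟨v, fun hvc => ?_, hΓ u hu v hv hvu⟩
  have hvt : Φ.φ v - Φ.φ t ∈ box 2 ℓs := (Φ.toPlanarSkeleton.mem_cyl t ℓs v).1 (cylBall_subset_cyl Φ t ℓs _ hv)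
  have hvcube : Φ.φ v - Φ.φ (cubeCtr Φ t i σ ℓs M) ∈ box 2 M :=
    (Φ.toPlanarSkeleton.mem_cyl _ M v).1 (cylBall_subset_cyl Φ _ M _ ((mem_fatSeq_iff Φ hC).1 hvc))
  have hc := (φ_cubeCtr Φ t i σ ℓs M).1
  have h1 := (mem_box.1 hvt) i
  have h2 := (mem_box.1 hvcube) i
  simp only [Pi.sub_apply] at h1 h2
  rcases Int.units_eq_one_or σ with rfl | rfl <;> push_cast at hc <;> omega

/-- **The face of a near contact lies on the inner boundary of its cube in the window graph** `winGraph G w₀ R` (the `hUib` of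
`Skel.kit_hIV_of_le/_of_route` for the plain window graph): `y ∈ B_G(w₀, R - r₀)` with `r₀ ≥ ℓs + 1 + T₀ + R'`,
`r₀ ≥ 2ℓs + 2 + T₀ + M + ψ M`, `R' ≥ cylRadMax ℓs (ℓs + 2 + M + ψ M)` put the face and the slab cylinder inside the ball, so the rung
edges are window-graph edges. [cite: KozmaNitzan2024, §4 p. 21 (U(P) ⊆ ∂Q)] -/
theorem cubeU_subset_innerBoundary_win {R' r₀ : ℕ} (hMℓ : M + 1 ≤ ℓs)
    (hwide : ∀ i, (lo - (j : Site 2)) i + 2 * tanOff ℓs M ≤ (hi + (j : Site 2)) i)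
    (hR' : Φ.cylRadMax ℓs (ℓs + 2 + M + fatRadius Φ hC M) ≤ R') (hr₀₁ : ℓs + 1 + tanOff ℓs M + R' ≤ r₀)
    (hr₀₂ : 2 * ℓs + 2 + tanOff ℓs M + M + fatRadius Φ hC M ≤ r₀) (hR : r₀ ≤ R) {x : V}
    (hx : x ∈ outerBoundary (winGraph G w₀ R) (winLevel Φ w₀ R lo hi j))
    (hnear : inNbr Φ w₀ R (Finset.Icc (lo - (j : Site 2)) (hi + (j : Site 2))) x ∈ graphBall G w₀ (R - r₀)) :
    cubeU Φ hC w₀ R lo hi j ℓs M x ⊆ innerBoundary (winGraph G w₀ R)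
      (fatSeq Φ hC (cubeCtr Φ (deepCtr Φ w₀ R (lo - (j : Site 2)) (hi + (j : Site 2)) ℓs M x)
        (exitDir Φ w₀ R (lo - (j : Site 2)) (hi + (j : Site 2)) x).1 (exitDir Φ w₀ R (lo - (j : Site 2)) (hi + (j : Site 2)) x).2 ℓs M) M) := by
  have hx' : x ∈ outerBoundary (winGraph G w₀ R) (Φ.Win w₀ (Finset.Icc (lo - (j : Site 2)) (hi + (j : Site 2))) R) := hx
  obtain ⟨-, -, hyP⟩ := inNbr_spec Φ hx'
  have hty := (deepCtr_spec Φ (ℓs := ℓs) (M := M) hwide hyP).1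
  rw [cubeU]
  refine cubeFace_subset_innerBoundary Φ hC hMℓ fun u hu v hv hvu => (winGraph_adj G).2 ⟨hvu.symm, ?_, ?_⟩
  · -- the face vertex is in the ball
    have huy := (cubeU_geom Φ hC hwide hx (by rw [cubeU]; exact hu)).2.1
    exact graphBall_mono G w₀ (by omega) (BoxProdZ2.mem_graphBall_add G hnear huy)
  · -- the slab vertex is in the ball
    have hvt : v ∈ graphBall G (deepCtr Φ w₀ R (lo - (j : Site 2)) (hi + (j : Site 2)) ℓs M x) R' :=
      graphBall_mono G _ hR' (Φ.cylBall_subset_prism _ ℓs _ hv).1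
    have hvy := BoxProdZ2.mem_graphBall_add G hty hvt
    exact graphBall_mono G w₀ (by omega) (BoxProdZ2.mem_graphBall_add G hnear hvy)

/-- **The cube face behind the deep slab meets the near-contact face conditions** of `SkelI.kitOK_slabDeep`: for `M + 1 ≤ ℓs`, box sides
`≥ 2T₀`, `R' ≥ cylRadMax ℓs (ℓs + 2 + M + ψ M)`, `2ℓs + 2 + T₀ + M + ψ M ≤ r₀ ≤ R`, `rs ≥ 2ℓs + 3 + T₀ + M + ψ M`, `cU ≥ (Δ+1)^{ψ M}` —
`sub` (near contact: `inNbr x ∈ B_G(w₀, R - r₀)`; planar via the shell box), `ball`, `adj` (the outward `step`-neighbour of a face vertex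
lies in the slab's cylinder ball `cylBall (deepCtr x) ℓs R'`), `card`, `one_le`. [cite: KozmaNitzan2024, §4 p. 21 (U(P) ⊆ ∂Q, Q ⊆ S)] -/
theorem nearFaceOK_cube {R' r₀ rs cU : ℕ} (hMℓ : M + 1 ≤ ℓs) (hwide : ∀ i, (lo - (j : Site 2)) i + 2 * tanOff ℓs M ≤ (hi + (j : Site 2)) i)
    (hR' : Φ.cylRadMax ℓs (ℓs + 2 + M + fatRadius Φ hC M) ≤ R') (hr₀ : 2 * ℓs + 2 + tanOff ℓs M + M + fatRadius Φ hC M ≤ r₀)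
    (hR : r₀ ≤ R) (hrs : 2 * ℓs + 3 + tanOff ℓs M + M + fatRadius Φ hC M ≤ rs) (hcU : (Φ.Δ + 1) ^ fatRadius Φ hC M ≤ cU) :
    NearFaceOKDeep Φ w₀ R lo hi j ℓs M R' r₀ rs cU (cubeU Φ hC w₀ R lo hi j ℓs M) where
  sub x hx hnear := by
    intro u hu
    obtain ⟨-, huy, hφu⟩ := cubeU_geom Φ hC hwide hx hu
    rw [mem_winLevel_iff]
    exact ⟨graphBall_mono G w₀ (by omega) (BoxProdZ2.mem_graphBall_add G hnear huy), mem_Icc_of_mem_shell hφu⟩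
  ball x hx _ u hu := graphBall_mono G x hrs (cubeU_geom Φ hC hwide hx hu).1
  adj x _ _ u hu := by
    rw [cubeU] at hu
    obtain ⟨v, hv, hvu⟩ := exists_step_mem_cylBall_of_mem_cubeFace Φ hC _ _ _ ℓs M hMℓ hu
    exact ⟨v, cylBall_mono Φ _ le_rfl hR' hv, hvu⟩
  card x _ _ := by
    rw [cubeU]
    exact (card_cubeFace_le Φ hC _ _ _ ℓs M).trans hcU
  one_le := le_trans (Nat.one_le_pow _ _ (Nat.succ_pos _)) hcU

/-- **The deep slab kit with cube faces** (assembly of `SkelI.kitOK_slabDeep` and `nearFaceOK_cube`): with `M + 1 ≤ ℓs` (so `1 ≤ ℓs`),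
box sides `≥ 2T₀`, a cylinder-ball radius `R'` dominating `cylRadMax ℓs (ℓs + 2 + 2T₀)` (the slab region) and
`cylRadMax ℓs (ℓs + 2 + M + ψ M)` (the rungs into the face), `ℓs + 1 + T₀ + R' ≤ r₀`, `2ℓs + 2 + T₀ + M + ψ M ≤ r₀ ≤ R`,
`rs ≥ ℓs + 2 + T₀ + R'`, `rs ≥ 2ℓs + 3 + T₀ + M + ψ M`, `cU ≥ (Δ+1)^{ψ M}`:
`KitOK Φ w₀ R lo hi j rs ((Δ+1)^{R'} + (T₀ + 2)) cU (slabGeomDeep … (cubeU …))` — the level-`j` seed kit of the generic exploration whose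
near-contact faces are Lemma-9 cube faces. [cite: KozmaNitzan2024, §4 p. 19 (Step III), p. 21 (Step IV geometry)] -/
theorem kitOK_slabCube {R' r₀ rs cU : ℕ} (hMℓ : M + 1 ≤ ℓs) (hwide : ∀ i, (lo - (j : Site 2)) i + 2 * tanOff ℓs M ≤ (hi + (j : Site 2)) i)
    (hR'₁ : Φ.cylRadMax ℓs (ℓs + 2 + 2 * tanOff ℓs M) ≤ R') (hR'₂ : Φ.cylRadMax ℓs (ℓs + 2 + M + fatRadius Φ hC M) ≤ R')
    (hr₀₁ : ℓs + 1 + tanOff ℓs M + R' ≤ r₀) (hr₀₂ : 2 * ℓs + 2 + tanOff ℓs M + M + fatRadius Φ hC M ≤ r₀) (hR : r₀ ≤ R)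
    (hrs₁ : ℓs + 2 + tanOff ℓs M + R' ≤ rs) (hrs₂ : 2 * ℓs + 3 + tanOff ℓs M + M + fatRadius Φ hC M ≤ rs)
    (hcU : (Φ.Δ + 1) ^ fatRadius Φ hC M ≤ cU) :
    KitOK Φ w₀ R lo hi j rs ((Φ.Δ + 1) ^ R' + (tanOff ℓs M + 2)) cU
      (slabGeomDeep Φ w₀ R lo hi j ℓs M R' r₀ (cubeU Φ hC w₀ R lo hi j ℓs M)) := by
  have hℓ : 1 ≤ ℓs := by omega
  refine kitOK_slabDeep Φ hwide (fun c v hv => ?_) hr₀₁ hR hrs₁ (nearFaceOK_cube Φ hC hMℓ hwide hR'₂ hr₀₂ hR hrs₂ hcU)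
  exact cylBall_mono Φ c le_rfl hR'₁ (Φ.prism_subset_cylBall c hℓ (ℓs + 2 + 2 * tanOff ℓs M) ⟨hv.1, hv.2⟩)

end Near

end SkelI

end Transplant

end Summit.CriticalPhenomena.PercolationContinuityZ3.Theorems

end
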